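import Summits.CriticalPhenomena.PercolationContinuityZ3.Theorems.SahiMasterFamilyRigidityAllTwoVoters

/-!
# Rigidity at every order — THEOREM R*: at most one active voter (the induction), and the trivial form

Support file of the master-family programme (crux `NoHeavyLowerTail`, stmt-CriticalPhenomena-4575; cell `prim-masterthm`, seat P4,
unit `prim-masterthm-p4-g8`).  Seat document HOME/prim-masterthm-p4/RIGIDITY-ALLK.md §2.  Sixth file: the induction on the live coordinates.

**THEOREM R\*** (`Good.atMostOne`, `Good.trivial_form`).  For a good system — increasing target `V₀`, voters `j ∈ J` with increasing `V_j ⊇ V₀` and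
nonempty arbitrary `Q_j`, and the identity `Σ_j μ_p(V_j ∩ Q_j) Π_{l≠j} μ_p(Q_l) = μ_p(V₀) Π_l μ_p(Q_l)` for all `p` (polynomial form `GI`) —
at most one voter is active (`V_j ∩ Q_j ≠ ∅`), and an active voter `j` has `Q_j` essentially disjoint from `V₀` with `V_j ∩ Q_j = V₀ ∩ Q_j`.
Proof: strong induction on the live set `S`; delete inactive voters; by the induction hypothesis every `0`-section and every admissible `1`-section
has at most one active voter; three or more active voters force the cylinder configuration of `Good.absurd_three`; exactly two force the antipodal
configuration of `Good.absurd_two` (part (b) of the induction hypothesis supplies `A_k ⊆ V₀` and the face-freeness of `V₀`).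
COROLLARY `rigidity_all` (R_m for every `m`): `Σ_j μ_p(U | Q_j) ≡ μ_p(U)` for an increasing `U ≠ ∅` and nonempty `Q_j` forces the trivial form.
HONEST FRAMING: a theorem about identities of conditional probabilities; Sahi `C_k` / Kahn's Conj. 5 / the master theorem remain OPEN.  [this work]
-/

noncomputable section

open scoped Classical

namespace Summit.CriticalPhenomena.PercolationContinuityZ3.Theorems

open Finset Function MvPolynomial
open Literature.Combinatorics.Sahi2008
open Literature.Probability.Percolation.BHK2006 (weight)
open Literature.Probability.Percolation.DecisionTree (ind ind_of_mem ind_of_not_mem ind_nonneg)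
open SharedCoordinate (Ignores xInd)
open ExpectationRigidity RigidityR3

namespace RigidityAll

variable {ι : Type*} [Fintype ι] {κ : Type*}
variable {S : Finset ι} {J : Finset κ} {V₀ : Set (Set ι)} {V Q : κ → Set (Set ι)}

/-! ### Activity in the sections -/

omit [Fintype ι] in
/-- A voter with an active configuration missing `x` is active in the `0`-section. [this work] -/
theorem sec0_active_of_exists {x : ι} {j : κ} (hω : ∃ ω ∈ V j ∩ Q j, x ∉ ω) :
    (secAt x (bsec x (Q j)) (V j) ∩ secAt x (bsec x (Q j)) (Q j)).Nonempty := by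
  obtain ⟨ω, hωA, hxω⟩ := hω
  have hnf : secAt x false (Q j) ≠ ∅ := fun hf => hxω ((secAt_false_eq_empty_iff x (Q j)).1 hf ω hωA.2)
  rw [bsec_of_ne hnf, secPair_nonempty_iff]
  exact ⟨ω, hωA, by simp [hxω]⟩

omit [Fintype ι] in
/-- An active voter that is inactive in the `0`-section has all its active configurations containing `x`. [this work] -/
theorem forall_mem_of_not_sec0_active {x : ι} {j : κ} (hna : ¬ (secAt x (bsec x (Q j)) (V j) ∩ secAt x (bsec x (Q j)) (Q j)).Nonempty) :
    ∀ ω ∈ V j ∩ Q j, x ∈ ω := by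
  intro ω hω
  by_contra hx
  exact hna (sec0_active_of_exists ⟨ω, hω, hx⟩)

omit [Fintype ι] in
/-- An active voter frozen to `1` at `x` is active in the `0`-section (it passes to its `1`-sections). [this work] -/
theorem sec0_active_of_frozen {x : ι} {j : κ} (hf : secAt x false (Q j) = ∅) (hact : (V j ∩ Q j).Nonempty) :
    (secAt x (bsec x (Q j)) (V j) ∩ secAt x (bsec x (Q j)) (Q j)).Nonempty := by
  rw [bsec_of_eq hf, secPair_nonempty_iff]
  obtain ⟨ω, hω⟩ := hact
  exact ⟨ω, hω, by simpa using (secAt_false_eq_empty_iff x (Q j)).1 hf ω hω.2⟩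

omit [Fintype ι] in
/-- Activity in the `1`-section. [this work] -/
theorem sec1_active_iff (x : ι) (j : κ) :
    (secAt x true (V j) ∩ secAt x true (Q j)).Nonempty ↔ ∃ ω ∈ V j ∩ Q j, x ∈ ω := by
  rw [secPair_nonempty_iff]; simp

omit [Fintype ι] in
/-- Dichotomy: an active voter is active in the `0`-section or in the `1`-section at `x`. [this work] -/
theorem sec0_active_or_sec1_active {x : ι} {j : κ} (hact : (V j ∩ Q j).Nonempty) :
    (secAt x (bsec x (Q j)) (V j) ∩ secAt x (bsec x (Q j)) (Q j)).Nonempty ∨ (secAt x true (V j) ∩ secAt x true (Q j)).Nonempty := by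
  by_cases hex : ∃ ω ∈ V j ∩ Q j, x ∉ ω
  · exact Or.inl (sec0_active_of_exists hex)
  · push Not at hex
    obtain ⟨ω, hω⟩ := hact
    exact Or.inr ((sec1_active_iff x j).2 ⟨ω, hω, hex ω hω⟩)

/-! ### The induction -/

/-- The statement proved by induction on the live set: at most one active voter. [this work] -/
def AtMostOne (J : Finset κ) (V Q : κ → Set (Set ι)) : Prop :=
  ∀ j₁ ∈ J, ∀ j₂ ∈ J, (V j₁ ∩ Q j₁).Nonempty → (V j₂ ∩ Q j₂).Nonempty → j₁ = j₂

/-- **The induction step.** [this work] -/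
theorem Good.atMostOne_step (h : Good S J V₀ V Q)
    (ih : ∀ T ⊂ S, ∀ (J' : Finset κ) (V₀' : Set (Set ι)) (V' Q' : κ → Set (Set ι)), Good T J' V₀' V' Q' → AtMostOne J' V' Q') :
    AtMostOne J V Q := by
  intro j₁ hj₁ j₂ hj₂ hact1 hact2
  by_contra hne
  -- delete the inactive voters
  set Jp := J.filter fun j => (V j ∩ Q j).Nonempty with hJp
  have hp : Good S Jp V₀ V Q := h.restrict (filter_subset _ J) fun j hj hj' => by
    rw [← Set.not_nonempty_iff_eq_empty]; exact fun hn => hj' (mem_filter.2 ⟨hj, hn⟩)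
  have hact : ∀ j ∈ Jp, (V j ∩ Q j).Nonempty := fun j hj => (mem_filter.1 hj).2
  have hj₁p : j₁ ∈ Jp := mem_filter.2 ⟨hj₁, hact1⟩
  have hj₂p : j₂ ∈ Jp := mem_filter.2 ⟨hj₂, hact2⟩
  -- (★0), (★1): at most one voter survives each section (induction hypothesis)
  have star0 : ∀ x ∈ S, AtMostOne Jp (fun j => secAt x (bsec x (Q j)) (V j)) (fun j => secAt x (bsec x (Q j)) (Q j)) :=
    fun x hx => ih _ (erase_ssubset hx) _ _ _ _ (hp.sec0 x)
  have star1 : ∀ x ∈ S, (∀ l ∈ Jp, (secAt x true (Q l)).Nonempty) →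
      AtMostOne Jp (fun j => secAt x true (V j)) (fun j => secAt x true (Q j)) :=
    fun x hx hQ => ih _ (erase_ssubset hx) _ _ _ _ (hp.sec1 x hQ)
  by_cases hthree : ∃ j₃ ∈ Jp, j₃ ≠ j₁ ∧ j₃ ≠ j₂
  · -- STEP m ≥ 3
    obtain ⟨j₃, hj₃p, h31, h32⟩ := hthree
    -- every live coordinate has a voter frozen to 0
    have hF : ∀ x ∈ S, ∃ l ∈ Jp, secAt x true (Q l) = ∅ := by
      intro x hx
      by_contra hno
      push Not at hno
      have s1 := star1 x hx fun l hl => hno l hl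
      have s0 := star0 x hx
      rcases sec0_active_or_sec1_active (x := x) (hact j₁ hj₁p) with a1 | a1 <;>
        rcases sec0_active_or_sec1_active (x := x) (hact j₂ hj₂p) with a2 | a2 <;>
          rcases sec0_active_or_sec1_active (x := x) (hact j₃ hj₃p) with a3 | a3
      · exact hne (s0 j₁ hj₁p j₂ hj₂p a1 a2)
      · exact hne (s0 j₁ hj₁p j₂ hj₂p a1 a2)
      · exact h31 (s0 j₃ hj₃p j₁ hj₁p a3 a1)
      · exact h32 (s1 j₃ hj₃p j₂ hj₂p a3 a2)
      · exact h32 (s0 j₃ hj₃p j₂ hj₂p a3 a2)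
      · exact h31 (s1 j₃ hj₃p j₁ hj₁p a3 a1)
      · exact hne (s1 j₁ hj₁p j₂ hj₂p a1 a2)
      · exact hne (s1 j₁ hj₁p j₂ hj₂p a1 a2)
    -- the frozen voter is the unique survivor of the 0-section: all others have their active sets inside `[x ∈ ω]`
    have hothers : ∀ x ∈ S, ∀ l ∈ Jp, secAt x true (Q l) = ∅ → ∀ j ∈ Jp, j ≠ l → ∀ ω ∈ V j ∩ Q j, x ∈ ω := by
      intro x hx l hl hfl j hj hjl
      have hl0 : (secAt x (bsec x (Q l)) (V l) ∩ secAt x (bsec x (Q l)) (Q l)).Nonempty := by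
        obtain ⟨ω, hω⟩ := hact l hl
        exact sec0_active_of_exists ⟨ω, hω, (secAt_true_eq_empty_iff x (Q l)).1 hfl ω hω.2⟩
      exact forall_mem_of_not_sec0_active fun hj0 => hjl (star0 x hx j hj l hl hj0 hl0)
    set ξ : κ → Finset ι := fun j => S.filter fun x => secAt x true (Q j) ≠ ∅ with hξ
    refine hp.absurd_three ξ (fun j _ => filter_subset _ S) ?_ ?_ hact ?_
    · intro j hj ω hω x hx
      constructor
      · intro hxω
        refine mem_filter.2 ⟨hx, fun hf => (secAt_true_eq_empty_iff x (Q j)).1 hf ω hω.2 hxω⟩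
      · intro hxξ
        obtain ⟨l, hl, hfl⟩ := hF x hx
        have hjl : j ≠ l := fun hjl => (mem_filter.1 hxξ).2 (hjl ▸ hfl)
        exact hothers x hx l hl hfl j hj hjl ω hω
    · intro j hj ω hω x hx hxξ
      have hf : secAt x true (Q j) = ∅ := by
        by_contra hf; exact hxξ (mem_filter.2 ⟨hx, hf⟩)
      exact (secAt_true_eq_empty_iff x (Q j)).1 hf ω hω
    · have hsub : ({j₁, j₂, j₃} : Finset κ) ⊆ Jp := by
        intro j hj
        simp only [mem_insert, mem_singleton] at hj
        rcases hj with rfl | rfl | rfl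
        · exact hj₁p
        · exact hj₂p
        · exact hj₃p
      have hcard : ({j₁, j₂, j₃} : Finset κ).card = 3 := by
        rw [card_insert_of_notMem (by simp [hne, Ne.symm h31]), card_pair (Ne.symm h32)]
      exact hcard ▸ card_le_card hsub
  · -- STEP m = 2: `Jp = {j₁, j₂}`
    push Not at hthree
    have hJp2 : Jp = {j₁, j₂} := by
      ext j
      simp only [mem_insert, mem_singleton]
      constructor
      · intro hj
        by_contra hno
        push Not at hno
        exact hno.2 (hthree j hj hno.1)
      · rintro (rfl | rfl)
        · exact hj₁p
        · exact hj₂p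
    rw [hJp2] at hp star0 star1 hact
    have hm₁ : j₁ ∈ ({j₁, j₂} : Finset κ) := by simp
    have hm₂ : j₂ ∈ ({j₁, j₂} : Finset κ) := by simp
    -- for each live `x`: one voter's active set lies in `[x ∈ ω]`, the other's in `[x ∉ ω]`
    have side : ∀ x ∈ S, ((∀ ω ∈ V j₁ ∩ Q j₁, x ∈ ω) ∧ (∀ ω ∈ V j₂ ∩ Q j₂, x ∉ ω)) ∨
        ((∀ ω ∈ V j₂ ∩ Q j₂, x ∈ ω) ∧ (∀ ω ∈ V j₁ ∩ Q j₁, x ∉ ω)) := by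
      intro x hx
      have s0 := star0 x hx
      by_cases hf1 : secAt x true (Q j₁) = ∅ <;> by_cases hf2 : secAt x true (Q j₂) = ∅
      · -- both frozen to 0: both survive the 0-section
        exfalso
        refine hne (s0 j₁ hm₁ j₂ hm₂ ?_ ?_)
        · obtain ⟨ω, hω⟩ := hact1
          exact sec0_active_of_exists ⟨ω, hω, (secAt_true_eq_empty_iff x _).1 hf1 ω hω.2⟩
        · obtain ⟨ω, hω⟩ := hact2
          exact sec0_active_of_exists ⟨ω, hω, (secAt_true_eq_empty_iff x _).1 hf2 ω hω.2⟩
      · -- `Q_{j₁}` frozen to 0: `j₁` survives, `j₂` dies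
        right
        have h1 : (secAt x (bsec x (Q j₁)) (V j₁) ∩ secAt x (bsec x (Q j₁)) (Q j₁)).Nonempty := by
          obtain ⟨ω, hω⟩ := hact1
          exact sec0_active_of_exists ⟨ω, hω, (secAt_true_eq_empty_iff x _).1 hf1 ω hω.2⟩
        exact ⟨forall_mem_of_not_sec0_active fun h2 => hne (s0 j₁ hm₁ j₂ hm₂ h1 h2),
          fun ω hω => (secAt_true_eq_empty_iff x _).1 hf1 ω hω.2⟩
      · left
        have h2 : (secAt x (bsec x (Q j₂)) (V j₂) ∩ secAt x (bsec x (Q j₂)) (Q j₂)).Nonempty := by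
          obtain ⟨ω, hω⟩ := hact2
          exact sec0_active_of_exists ⟨ω, hω, (secAt_true_eq_empty_iff x _).1 hf2 ω hω.2⟩
        exact ⟨forall_mem_of_not_sec0_active fun h1 => hne (s0 j₁ hm₁ j₂ hm₂ h1 h2),
          fun ω hω => (secAt_true_eq_empty_iff x _).1 hf2 ω hω.2⟩
      · -- neither frozen to 0: the 1-section is admissible
        have s1 := star1 x hx fun l hl => by
          simp only [mem_insert, mem_singleton] at hl
          rcases hl with rfl | rfl
          · exact Set.nonempty_iff_ne_empty.2 hf1
          · exact Set.nonempty_iff_ne_empty.2 hf2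
        by_cases h10 : (secAt x (bsec x (Q j₁)) (V j₁) ∩ secAt x (bsec x (Q j₁)) (Q j₁)).Nonempty
        · right
          have h2in : ∀ ω ∈ V j₂ ∩ Q j₂, x ∈ ω := forall_mem_of_not_sec0_active fun h20 => hne (s0 j₁ hm₁ j₂ hm₂ h10 h20)
          have h21 : (secAt x true (V j₂) ∩ secAt x true (Q j₂)).Nonempty := by
            obtain ⟨ω, hω⟩ := hact2
            exact (sec1_active_iff x j₂).2 ⟨ω, hω, h2in ω hω⟩
          refine ⟨h2in, fun ω hω hxω => hne (s1 j₁ hm₁ j₂ hm₂ ((sec1_active_iff x j₁).2 ⟨ω, hω, hxω⟩) h21)⟩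
        · left
          have h1in : ∀ ω ∈ V j₁ ∩ Q j₁, x ∈ ω := forall_mem_of_not_sec0_active h10
          have h11 : (secAt x true (V j₁) ∩ secAt x true (Q j₁)).Nonempty := by
            obtain ⟨ω, hω⟩ := hact1
            exact (sec1_active_iff x j₁).2 ⟨ω, hω, h1in ω hω⟩
          refine ⟨h1in, fun ω hω hxω => hne (s1 j₁ hm₁ j₂ hm₂ h11 ((sec1_active_iff x j₂).2 ⟨ω, hω, hxω⟩))⟩
    -- the two patterns
    set T₁ := S.filter fun x => ∀ ω ∈ V j₁ ∩ Q j₁, x ∈ ω with hT₁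
    set T₂ := S.filter fun x => ∀ ω ∈ V j₂ ∩ Q j₂, x ∈ ω with hT₂
    have hcov : ∀ i ∈ S, i ∈ T₁ ∨ i ∈ T₂ := by
      intro i hi
      rcases side i hi with h1 | h2
      · exact Or.inl (mem_filter.2 ⟨hi, h1.1⟩)
      · exact Or.inr (mem_filter.2 ⟨hi, h2.1⟩)
    have hdisj : Disjoint T₁ T₂ := by
      rw [Finset.disjoint_left]
      intro i hi1 hi2
      obtain ⟨ω₁, hω₁⟩ := hact1
      obtain ⟨ω₂, hω₂⟩ := hact2
      rcases side i (mem_filter.1 hi1).1 with h1 | h2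
      · exact h1.2 ω₂ hω₂ ((mem_filter.1 hi2).2 ω₂ hω₂)
      · exact h2.2 ω₁ hω₁ ((mem_filter.1 hi1).2 ω₁ hω₁)
    -- patterns of the active sets
    have hpat1 : ∀ ω ∈ V j₁ ∩ Q j₁, ∀ x ∈ S, (x ∈ ω ↔ x ∈ T₁) := by
      intro ω hω x hx
      rcases side x hx with h1 | h2
      · exact ⟨fun _ => mem_filter.2 ⟨hx, h1.1⟩, fun _ => h1.1 ω hω⟩
      · constructor
        · intro hxω; exact absurd hxω (h2.2 ω hω)
        · intro hxT; exact (mem_filter.1 hxT).2 ω hω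
    have hpat2 : ∀ ω ∈ V j₂ ∩ Q j₂, ∀ x ∈ S, (x ∈ ω ↔ x ∈ T₂) := by
      intro ω hω x hx
      rcases side x hx with h1 | h2
      · constructor
        · intro hxω; exact absurd hxω (h1.2 ω hω)
        · intro hxT; exact (mem_filter.1 hxT).2 ω hω
      · exact ⟨fun _ => mem_filter.2 ⟨hx, h2.1⟩, fun _ => h2.1 ω hω⟩
    have hA1 : ∀ ω, ω ∈ V j₁ ∩ Q j₁ ↔ ∀ x ∈ S, (x ∈ ω ↔ x ∈ T₁) := by
      intro ω
      refine ⟨hpat1 ω, fun hω => ?_⟩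
      obtain ⟨ω₀, hω₀⟩ := hact1
      have heq : ω ∩ ↑S = ω₀ ∩ ↑S := by
        ext i
        simp only [Set.mem_inter_iff, mem_coe]
        constructor
        · rintro ⟨hi, hiS⟩; exact ⟨(hpat1 ω₀ hω₀ i hiS).2 ((hω i hiS).1 hi), hiS⟩
        · rintro ⟨hi, hiS⟩; exact ⟨(hω i hiS).2 ((hpat1 ω₀ hω₀ i hiS).1 hi), hiS⟩
      exact ⟨(mem_iff_of_inter_eq (hp.freeV j₁ hm₁) heq).2 hω₀.1, (mem_iff_of_inter_eq (hp.freeQ j₁ hm₁) heq).2 hω₀.2⟩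
    have hA2 : ∀ ω, ω ∈ V j₂ ∩ Q j₂ ↔ ∀ x ∈ S, (x ∈ ω ↔ x ∈ T₂) := by
      intro ω
      refine ⟨hpat2 ω, fun hω => ?_⟩
      obtain ⟨ω₀, hω₀⟩ := hact2
      have heq : ω ∩ ↑S = ω₀ ∩ ↑S := by
        ext i
        simp only [Set.mem_inter_iff, mem_coe]
        constructor
        · rintro ⟨hi, hiS⟩; exact ⟨(hpat2 ω₀ hω₀ i hiS).2 ((hω i hiS).1 hi), hiS⟩
        · rintro ⟨hi, hiS⟩; exact ⟨(hω i hiS).2 ((hpat2 ω₀ hω₀ i hiS).1 hi), hiS⟩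
      exact ⟨(mem_iff_of_inter_eq (hp.freeV j₂ hm₂) heq).2 hω₀.1, (mem_iff_of_inter_eq (hp.freeQ j₂ hm₂) heq).2 hω₀.2⟩
    -- both patterns nonempty (else `∅` is active, `V_j = 2^E`)
    have hp' : Good S {j₂, j₁} V₀ V Q := by rw [pair_comm]; exact hp
    have hne1 : T₁.Nonempty := by
      rw [nonempty_iff_ne_empty]
      intro hT
      have h0 : (∅ : Set ι) ∈ V j₁ ∩ Q j₁ := (hA1 ∅).2 fun x _ => by simp [hT]
      exact hp'.absurd_of_empty_mem (Ne.symm hne) hact2 h0.1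
    have hne2 : T₂.Nonempty := by
      rw [nonempty_iff_ne_empty]
      intro hT
      have h0 : (∅ : Set ι) ∈ V j₂ ∩ Q j₂ := (hA2 ∅).2 fun x _ => by simp [hT]
      exact hp.absurd_of_empty_mem hne hact1 h0.1
    -- part (b) of the induction hypothesis in the 0-sections
    have partB : ∀ {a b : κ} {Ta Tb : Finset ι}, ({a, b} : Finset κ) = {j₁, j₂} → a ≠ b → Disjoint Ta Tb →
        (∀ ω, ω ∈ V a ∩ Q a ↔ ∀ x ∈ S, (x ∈ ω ↔ x ∈ Ta)) → Tb ⊆ S →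
        ∀ x ∈ Tb, V a ∩ Q a ⊆ V₀ ∧ ∀ y ∈ Tb, y ≠ x → ∀ ω : Set ι, x ∉ ω → (insert y ω ∈ V₀ ↔ ω ∈ V₀) := by
      intro a b Ta Tb hab hne' hdj hAa hTb x hx
      have hpa : Good S {a, b} V₀ V Q := by rw [hab]; exact hp
      have hma : a ∈ ({a, b} : Finset κ) := by simp
      have hmb : b ∈ ({a, b} : Finset κ) := by simp
      have hxS : x ∈ S := hTb hx
      have hcTa : (↑Ta : Set ι) ∈ V a ∩ Q a := coe_mem_active hAa
      have hxTa : x ∉ (↑Ta : Set ι) := fun h' => disjoint_left.1 hdj (mem_coe.1 h') hx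
      -- `a` survives the 0-section at `x`, so `b` does not
      have ha0 : (secAt x (bsec x (Q a)) (V a) ∩ secAt x (bsec x (Q a)) (Q a)).Nonempty :=
        sec0_active_of_exists ⟨_, hcTa, hxTa⟩
      have hnf : secAt x false (Q a) ≠ ∅ := fun hf => hxTa ((secAt_false_eq_empty_iff x (Q a)).1 hf _ hcTa.2)
      have s0 : AtMostOne ({a, b} : Finset κ) (fun j => secAt x (bsec x (Q j)) (V j)) (fun j => secAt x (bsec x (Q j)) (Q j)) := by
        have := star0 x hxS; rwa [← hab] at this
      have hb0 : secAt x (bsec x (Q b)) (V b) ∩ secAt x (bsec x (Q b)) (Q b) = ∅ := by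
        rw [← Set.not_nonempty_iff_eq_empty]
        exact fun hb => hne' (s0 a hma b hmb ha0 hb)
      have hsingle := (hpa.sec0 x).single hma ha0 fun l hl hla => by
        simp only [mem_insert, mem_singleton] at hl
        rcases hl with rfl | rfl
        · exact absurd rfl hla
        · exact hb0
      rw [bsec_of_ne hnf] at hsingle
      obtain ⟨hor, heq⟩ := hsingle
      constructor
      · -- `A_a ⊆ V₀`
        intro ω hω
        have hxω : x ∉ ω := fun h' => hxTa (by
          have := (hAa ω).1 hω x hxS; exact mem_coe.2 (this.1 h'))
        have hmem : ω ∈ secAt x false (V a) ∩ secAt x false (Q a) :=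
          ⟨mem_secAt_of_mem hω.1 (by simp [hxω]), mem_secAt_of_mem hω.2 (by simp [hxω])⟩
        rw [heq] at hmem
        have := mem_secAt.1 hmem.1
        simpa [forceAt, Set.sdiff_singleton_eq_self hxω] using this
      · -- freeness of `V₀` in `y ∈ Tb ∖ x` on the face `x ∉ ω`
        intro y hy hyx ω hxω
        have hyfree : ∀ ω', insert y ω' ∈ secAt x false V₀ ↔ ω' ∈ secAt x false V₀ := by
          refine forall_iff_of_ignores ((hor y).resolve_right fun hig => ?_)
          -- `Q_a^{x←0}` free at `y ∈ Tb` would put `Ta ∪ {y}` in the active set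
          have hcQ : (↑Ta : Set ι) ∈ secAt x false (Q a) := mem_secAt_of_mem hcTa.2 (by simp [hxTa])
          have hins : insert y (↑Ta : Set ι) ∈ secAt x false (Q a) := (forall_iff_of_ignores hig _).2 hcQ
          have hins' : insert y (↑Ta : Set ι) ∈ Q a := by
            have := mem_secAt.1 hins
            have hxn : x ∉ insert y (↑Ta : Set ι) := by
              simp only [Set.mem_insert_iff, not_or]; exact ⟨fun h' => hyx h'.symm, hxTa⟩
            simpa [forceAt, Set.sdiff_singleton_eq_self hxn] using this
          have hinsV : insert y (↑Ta : Set ι) ∈ V a := hpa.up a hma (Set.subset_insert _ _) hcTa.1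
          have := ((hAa _).1 ⟨hinsV, hins'⟩ y (hTb hy)).1 (Set.mem_insert _ _)
          exact disjoint_left.1 hdj this hy
        have h1 := hyfree ω
        rw [mem_secAt, mem_secAt] at h1
        have hxn : x ∉ insert y ω := by
          simp only [Set.mem_insert_iff, not_or]; exact ⟨fun h' => hyx h'.symm, hxω⟩
        simpa [forceAt, Set.sdiff_singleton_eq_self hxn, Set.sdiff_singleton_eq_self hxω] using h1
    have hT₁S : T₁ ⊆ S := filter_subset _ S
    have hT₂S : T₂ ⊆ S := filter_subset _ S
    obtain ⟨x₂, hx₂⟩ := hne2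
    obtain ⟨x₁, hx₁⟩ := hne1
    have hB1 := partB rfl hne hdisj hA1 hT₂S x₂ hx₂
    have hB2 := partB (pair_comm j₂ j₁) (Ne.symm hne) hdisj.symm hA2 hT₁S x₁ hx₁
    refine hp.absurd_two hne hcov hdisj hT₁S hT₂S hA1 hA2 hB1.1 hB2.1 ?_ ?_ ⟨x₁, hx₁⟩ ⟨x₂, hx₂⟩
    · intro x hx y hy hyx ω hxω
      exact (partB rfl hne hdisj hA1 hT₂S x hx).2 y hy hyx ω hxω
    · intro x hx y hy hyx ω hxω
      exact (partB (pair_comm j₂ j₁) (Ne.symm hne) hdisj.symm hA2 hT₁S x hx).2 y hy hyx ω hxω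

/-- **THEOREM R\* (a): a good voter system has at most one active voter.** [this work] -/
theorem Good.atMostOne (h : Good S J V₀ V Q) : AtMostOne J V Q := by
  induction S using Finset.strongInduction generalizing J V₀ V Q with
  | H S ih => exact h.atMostOne_step fun T hT J' V₀' V' Q' h' => ih T hT h'

/-- **THEOREM R\* (b): the trivial form.**  An active voter `j` of a good system has `Q_j` essentially disjoint from `V₀` and `V_j ∩ Q_j = V₀ ∩ Q_j`;
every other voter is inactive. [this work] -/
theorem Good.trivial_form (h : Good S J V₀ V Q) {j : κ} (hj : j ∈ J) (hact : (V j ∩ Q j).Nonempty) :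
    (∀ l ∈ J, l ≠ j → V l ∩ Q l = ∅) ∧ (∀ y, Ignores y (ind V₀) ∨ Ignores y (ind (Q j))) ∧ V j ∩ Q j = V₀ ∩ Q j := by
  have hothers : ∀ l ∈ J, l ≠ j → V l ∩ Q l = ∅ := by
    intro l hl hlj
    rw [← Set.not_nonempty_iff_eq_empty]
    exact fun hl' => hlj (h.atMostOne l hl j hj hl' hact)
  exact ⟨hothers, h.single hj hact hothers⟩

/-! ### COROLLARY R_m: one increasing target -/

/-- **RIGIDITY AT EVERY ORDER (R_m).**  Let `U` be a nonempty increasing event and `Q_j` (`j ∈ J`) nonempty events with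
`Σ_{j∈J} μ_p(U ∩ Q_j) Π_{l≠j} μ_p(Q_l) = μ_p(U) Π_l μ_p(Q_l)` for every interior `p` (i.e. `Σ_j μ_p(U | Q_j) = μ_p(U)`).  Then some `j₀ ∈ J` meets `U`,
every other `Q_l` is disjoint from `U`, and no coordinate is essential for both `U` and `Q_{j₀}`. [this work] -/
theorem rigidity_all {U : Set (Set ι)} (hU : IsUpperSet U) (hUne : U.Nonempty) {J : Finset κ} {Q : κ → Set (Set ι)}
    (hQ : ∀ j ∈ J, (Q j).Nonempty)
    (hI : ∀ p : ι → unitInterval, (∀ e, (p e : ℝ) ∈ Set.Ioo (0 : ℝ) 1) →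
      ∑ j ∈ J, ex (bernoulliWeight p) (ind (U ∩ Q j)) * ∏ l ∈ J.erase j, ex (bernoulliWeight p) (ind (Q l)) =
        ex (bernoulliWeight p) (ind U) * ∏ l ∈ J, ex (bernoulliWeight p) (ind (Q l))) :
    ∃ j₀ ∈ J, (Q j₀ ∩ U).Nonempty ∧ (∀ l ∈ J, l ≠ j₀ → Q l ∩ U = ∅) ∧ (∀ y, Ignores y (ind U) ∨ Ignores y (ind (Q j₀))) := by
  have hg : Good (univ : Finset ι) J U (fun _ => U) Q :=
    { up0 := hU, up := fun _ _ => hU, sub := fun _ _ => subset_rfl, ne := hQ,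
      free0 := fun y hy => absurd (mem_univ y) hy, freeV := fun _ _ y hy => absurd (mem_univ y) hy,
      freeQ := fun _ _ y hy => absurd (mem_univ y) hy, gi := gi_of_forall_interior hI }
  -- some voter is active: otherwise the left side of (GI) vanishes but the right side does not
  have hex : ∃ j₀ ∈ J, (U ∩ Q j₀).Nonempty := by
    by_contra hno
    push Not at hno
    have hgi := hg.gi
    unfold GI at hgi
    rw [sum_eq_zero fun j hj => by simp only [hno j hj, ind_empty_eq, exPoly_zero, zero_mul]] at hgi
    exact mul_ne_zero (exPoly_ind_ne_zero hUne) (prod_exPoly_ind_ne_zero hQ) hgi.symm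
  obtain ⟨j₀, hj₀, hact⟩ := hex
  obtain ⟨hothers, hor, -⟩ := hg.trivial_form hj₀ hact
  refine ⟨j₀, hj₀, by rwa [Set.inter_comm], fun l hl hlj => by rw [Set.inter_comm]; exact hothers l hl hlj, hor⟩

end RigidityAll

end Summit.CriticalPhenomena.PercolationContinuityZ3.Theorems
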